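import Summits.ResolutionOfSingularities.ResolutionOfSingularities.Theses.UniversalCells
import Literature.AlgebraicGeometry.Resolution.AffineBlowupRegular
import Literature.AlgebraicGeometry.Resolution.AffineBlowupCartier
import Literature.AlgebraicGeometry.Resolution.AffineBlowupIntegral
import Literature.AlgebraicGeometry.Resolution.BlowupChartQuasiRegular
import Literature.AlgebraicGeometry.Resolution.MvPolynomialKillVars

/-!
# `UniversalCells.LocalToGlobal` — negative lemmas: the local resolutions of `H_p` are not rigid

Support (negative) lemmas for the crux `stmt-ResolutionOfSingularities-15232`
(`Summit.ResolutionOfSingularities.ResolutionOfSingularities.Theses.UniversalCells.LocalToGlobal`,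
route `UniversalCells`, rank 4: for every prime `p`, pointwise Zariski-local resolvability `H_p`
of every integral separated finite-type `𝔽_p`-scheme implies global resolvability `R_p`).
Filed by the crux disprover (cdisprove seat, 2026-08-17); companion of
`Negative/LoadBearing.lean` (shape, irrefutability, integrality / finite-type guards).

## What is refuted here, and why it concerns the load-bearing hypothesis `H_p`

`H_p` hands out, around every point, SOME resolution of an open neighbourhood — bare existence,
weak form (no condition over the regular locus). Every gluing argument on record for the crux
(Kollár 2007, Rem. 3.28: local resolutions glue when they are well defined and AGREE on
overlaps; the lead's LINE-STATUS (A3) and the strategist's census F1/T1/S1–S2 for this crux)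
needs the local data to be RIGID in one of the following senses, each of which would make
`H_p ⇒ R_p` immediate. All three are false, already over the affine plane, at every field `k`
(in particular `k = 𝔽_p` for every prime `p`), by ONE kernel-checked witness — the blowing up
`Bl_{(X₀,X₁)} 𝔸²_k → 𝔸²_k` of the plane at the origin (tree: `AffineBlowup*.lean`,
`BlowupChartQuasiRegular.lean`):

* `exists_isResolution_of_isRegular_not_isIso` — a resolution of a REGULAR integral separated
  finite-type `k`-scheme need not be an isomorphism ("resolutions of regular opens are trivial"
  is false);
* `resolutions_not_unique` — two resolutions of the same `X` need not be isomorphic over `X`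
  ("existence ⇒ uniqueness", the property that makes Zariski-local resolutions glue for free,
  is false: `𝟙` and the blowing up);
* `resolution_not_isIso_over_regularLocus` — a (weak) resolution need not be an isomorphism
  over the regular locus of the base ("weak ⇒ strong for free" is false), so the weak local
  resolutions of `H_p` cannot be cut back to the identity over `Reg` and patched with it.

The engine is the general point-count `affineBlowup_base_not_injective` /
`affineBlowup_not_isIso`: for a quasi-regular centre `x = (x_1, …, x_r)`, `r ≥ 2`, with `R/(x)`
a domain, the chart `D₊(x_i t)` of `Bl_{(x)}(Spec R)` contains the affine line
`Spec (R/(x))[T_j]` over `V(x)` (`(R[It])_{(x_i t)}/(x_i) ≅ (R/(x))[T_j : j ≠ i]`,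
`ker_quotient_comp_eval₂Hom_eq`), two of whose points (`T_j = 0`, `T_j = 1`) have the same
image in `Spec R`; so `π` is not injective on points, hence not an isomorphism, while it IS a
resolution of the regular scheme `𝔸²` (`affineBlowup.isRegular_of_isWeaklyRegular`,
`affineBlowup.isResolution`).

Consequence for provers (informative, not a refutation of the crux): any proof of
`LocalToGlobal` must MODIFY the local resolutions before gluing (dominate / re-resolve the join,
i.e. two-model patching — `Theorems.localToGlobal_iff_twoModelPatchingAt`), never merely
restrict and identify them. The crux itself stays irrefutable short of refuting the summit
(`Negative.not_localToGlobal_iff`).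

## Sources
* J. Kollár, *Lectures on Resolution of Singularities*, Ann. of Math. Stud. 166 (2007), Ch. 3
  intro item (4) and Rem. 3.28 / Ex. 3.28.1 (patching local resolutions needs agreement on
  overlaps).
* Q. Liu, *Algebraic Geometry and Arithmetic Curves*, OUP 2002, Thm. 8.1.19 (blowing up a
  regular scheme along a regular centre is regular; exceptional divisor a projective bundle).
* The Stacks Project, Tags 0804, 02OS, 0BIQ (blowing up, its charts, affine blowup algebras).
-/

noncomputable section

-- single-problem summit: the doubled namespace component `ResolutionOfSingularities` is forced
set_option linter.dupNamespace false

open CategoryTheory AlgebraicGeometry Literature.AlgebraicGeometry.Resolution HomogeneousLocalization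

namespace Summit.ResolutionOfSingularities.ResolutionOfSingularities.Theorems.LocalToGlobal.Negative

universe u

section General

variable {R : Type u} [CommRing R] {r : ℕ} (x : Fin r → R) (i j : Fin r)

/-- The blowing up of `Spec R` along a quasi-regular centre `x = (x_1,…,x_r)` of length `≥ 2`
with `R/(x)` a domain is NOT injective on points: over the closed set `V(x)` the chart
`D₊(x_i t) = Spec (R[It])_{(x_i t)}` contains the affine line `Spec (R/(x))[T_j]`
(`(R[It])_{(x_i t)}/(x_i) ≅ (R/(x))[T_j : j ≠ i]`), two of whose points (`T_j = 0`, `T_j = 1`)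
lie over the same point of `V(x) ⊆ Spec R`. [cite: StacksProject, Tag 0BIQ] -/
theorem affineBlowup_base_not_injective (hij : j ≠ i) (hx : IsQuasiRegular x)
    [IsDomain (R ⧸ Ideal.span (Set.range x))] :
    ¬ Function.Injective (affineBlowup.π (Ideal.span (Set.range x))).base := by
  -- notation
  have hi : x i ∈ Ideal.span (Set.range x) := Ideal.mem_span_range_self (f := x) (x := i)
  let B := Away (reesGrading (Ideal.span (Set.range x))) (reesT (x i) hi)
  let φ : R →+* B := reesChartBase (x i) hi
  let e' : {j : Fin r // j ≠ i} → B := fun j =>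
    HomogeneousLocalization.Away.mk (reesGrading (Ideal.span (Set.range x))) (reesT_mem (x i) hi)
      1 (reesT (x j.1) (Ideal.mem_span_range_self (f := x) (x := j.1))) (reesT_mem_one_smul x j.1)
  let θ : MvPolynomial {j : Fin r // j ≠ i} R →+* B ⧸ Ideal.span {φ (x i)} :=
    (Ideal.Quotient.mk (Ideal.span {φ (x i)})).comp (MvPolynomial.eval₂Hom φ e')
  have hθs : Function.Surjective θ := quotient_comp_eval₂Hom_surjective x i
  have hθk : RingHom.ker θ = Ideal.map MvPolynomial.C (Ideal.span (Set.range x)) :=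
    ker_quotient_comp_eval₂Hom_eq x i hx
  -- evaluation `T ↦ c` over the centre
  let lam (c : R ⧸ Ideal.span (Set.range x)) : MvPolynomial {j : Fin r // j ≠ i} R →+*
      R ⧸ Ideal.span (Set.range x) :=
    MvPolynomial.eval₂Hom (Ideal.Quotient.mk _) (fun _ => c)
  have hlam (c : R ⧸ Ideal.span (Set.range x)) : RingHom.ker θ ≤ RingHom.ker (lam c) := by
    rw [hθk, Ideal.map_le_iff_le_comap]
    intro a ha
    rw [Ideal.mem_comap, RingHom.mem_ker, MvPolynomial.eval₂Hom_C, Ideal.Quotient.eq_zero_iff_mem]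
    exact ha
  let μ (c : R ⧸ Ideal.span (Set.range x)) : (B ⧸ Ideal.span {φ (x i)}) →+*
      R ⧸ Ideal.span (Set.range x) :=
    θ.liftOfSurjective hθs ⟨lam c, hlam c⟩
  let ψ (c : R ⧸ Ideal.span (Set.range x)) : B →+* R ⧸ Ideal.span (Set.range x) :=
    (μ c).comp (Ideal.Quotient.mk _)
  have hψφ (c : R ⧸ Ideal.span (Set.range x)) (a : R) : ψ c (φ a) = Ideal.Quotient.mk _ a := by
    have h1 : Ideal.Quotient.mk (Ideal.span {φ (x i)}) (φ a) = θ (MvPolynomial.C a) := by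
      simp only [θ, RingHom.comp_apply, MvPolynomial.eval₂Hom_C]
    change μ c (Ideal.Quotient.mk (Ideal.span {φ (x i)}) (φ a)) = _
    rw [h1]
    erw [RingHom.liftOfSurjective_comp_apply]
    simp only [lam, MvPolynomial.eval₂Hom_C]
  have hψe (c : R ⧸ Ideal.span (Set.range x)) : ψ c (e' ⟨j, hij⟩) = c := by
    have h1 : Ideal.Quotient.mk (Ideal.span {φ (x i)}) (e' ⟨j, hij⟩) =
        θ (MvPolynomial.X ⟨j, hij⟩) := by
      simp only [θ, RingHom.comp_apply, MvPolynomial.eval₂Hom_X']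
    change μ c (Ideal.Quotient.mk (Ideal.span {φ (x i)}) (e' ⟨j, hij⟩)) = _
    rw [h1]
    erw [RingHom.liftOfSurjective_comp_apply]
    simp only [lam, MvPolynomial.eval₂Hom_X']
  -- the two points of the chart
  let P (c : R ⧸ Ideal.span (Set.range x)) : Spec (.of B) :=
    ⟨RingHom.ker (ψ c), RingHom.ker_isPrime _⟩
  have hP : P 0 ≠ P 1 := by
    intro h
    have h' : RingHom.ker (ψ 0) = RingHom.ker (ψ 1) := congrArg PrimeSpectrum.asIdeal h
    have h0 : e' ⟨j, hij⟩ ∈ RingHom.ker (ψ 0) := by rw [RingHom.mem_ker, hψe]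
    rw [h', RingHom.mem_ker, hψe] at h0
    exact one_ne_zero h0
  have himg : (Spec.map (CommRingCat.ofHom φ)).base (P 0) =
      (Spec.map (CommRingCat.ofHom φ)).base (P 1) := by
    apply PrimeSpectrum.ext
    change Ideal.comap φ (RingHom.ker (ψ 0)) = Ideal.comap φ (RingHom.ker (ψ 1))
    ext a
    simp only [Ideal.mem_comap, RingHom.mem_ker, hψφ]
  -- conclude
  intro hinj
  apply hP
  have hι : Function.Injective (affineBlowup.chartι (I := Ideal.span (Set.range x)) (x i) hi).base :=
    (affineBlowup.chartι (I := Ideal.span (Set.range x)) (x i) hi).isOpenEmbedding.injective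
  apply hι
  apply hinj
  have hc := affineBlowup.chartι_π (I := Ideal.span (Set.range x)) (x i) hi
  have h0 : (affineBlowup.π (Ideal.span (Set.range x))).base
      ((affineBlowup.chartι (I := Ideal.span (Set.range x)) (x i) hi).base (P 0)) =
      (Spec.map (CommRingCat.ofHom φ)).base (P 0) := by
    rw [← hc]; rfl
  have h1 : (affineBlowup.π (Ideal.span (Set.range x))).base
      ((affineBlowup.chartι (I := Ideal.span (Set.range x)) (x i) hi).base (P 1)) =
      (Spec.map (CommRingCat.ofHom φ)).base (P 1) := by
    rw [← hc]; rfl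
  rw [h0, h1, himg]

/-- Hence such a blowing up is not an isomorphism. [folklore] -/
theorem affineBlowup_not_isIso (hij : j ≠ i) (hx : IsQuasiRegular x)
    [IsDomain (R ⧸ Ideal.span (Set.range x))] :
    ¬ IsIso (affineBlowup.π (Ideal.span (Set.range x))) := by
  intro h
  exact affineBlowup_base_not_injective x i j hij hx
    (affineBlowup.π (Ideal.span (Set.range x))).isOpenEmbedding.injective

end General

/-! ## The blowing up of the affine plane at the origin -/

section Plane

variable (k : Type) [Field k]

/-- The two coordinates of the affine plane form a quasi-regular sequence. [folklore] -/
theorem isQuasiRegular_X_plane :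
    IsQuasiRegular (MvPolynomial.X : Fin 2 → MvPolynomial (Fin 2) k) := by
  refine isQuasiRegular_of_isWeaklyRegular _ ?_
  rw [List.ofFn_eq_map]
  exact Literature.AlgebraicGeometry.Resolution.MvPolynomial.isWeaklyRegular_map_X
    (R := k) (List.finRange 2) (List.nodup_finRange 2)

/-- `k[X₀, X₁]/(X₀, X₁) ≅ k[∅]` (killing all the variables). [folklore] -/
theorem nonempty_quotOriginEquiv :
    Nonempty ((MvPolynomial (Fin 2) k ⧸
      Ideal.span (Set.range (MvPolynomial.X : Fin 2 → MvPolynomial (Fin 2) k))) ≃+*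
      MvPolynomial {j : Fin 2 // j ∉ (Set.univ : Set (Fin 2))} k) :=
  ⟨(Ideal.quotEquivOfEq (by rw [Set.image_univ])).trans
    (Literature.AlgebraicGeometry.Resolution.MvPolynomial.quotientSpanXEquiv
      (R := k) (Set.univ : Set (Fin 2))).toRingEquiv⟩

/-- The centre `(X₀, X₁)` is a prime ideal: the quotient is a domain. [folklore] -/
theorem isDomain_quot_origin :
    IsDomain (MvPolynomial (Fin 2) k ⧸
      Ideal.span (Set.range (MvPolynomial.X : Fin 2 → MvPolynomial (Fin 2) k))) := by
  obtain ⟨e⟩ := nonempty_quotOriginEquiv k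
  exact e.toMulEquiv.isDomain _

/-- The quotient by the centre is a regular ring (a polynomial ring in no variables over a
field). [folklore] -/
theorem isRegularRing_quot_origin :
    IsRegularRing (MvPolynomial (Fin 2) k ⧸
      Ideal.span (Set.range (MvPolynomial.X : Fin 2 → MvPolynomial (Fin 2) k))) := by
  obtain ⟨e⟩ := nonempty_quotOriginEquiv k
  exact IsRegularRing.of_ringEquiv e.symm

/-- The centre is a nonzero ideal. [folklore] -/
theorem span_X_plane_ne_bot :
    Ideal.span (Set.range (MvPolynomial.X : Fin 2 → MvPolynomial (Fin 2) k)) ≠ ⊥ := by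
  intro h
  have hmem : (MvPolynomial.X 0 : MvPolynomial (Fin 2) k) ∈
      Ideal.span (Set.range (MvPolynomial.X : Fin 2 → MvPolynomial (Fin 2) k)) :=
    Ideal.subset_span ⟨0, rfl⟩
  rw [h, Ideal.mem_bot] at hmem
  exact MvPolynomial.X_ne_zero 0 hmem

/-- **The blowing up of the affine plane at the origin is a resolution of singularities of the
(regular) plane which is not an isomorphism.** [folklore] -/
theorem blowupPlane_isResolution_not_isIso :
    IsResolution (affineBlowup.π
        (Ideal.span (Set.range (MvPolynomial.X : Fin 2 → MvPolynomial (Fin 2) k)))) ∧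
      ¬ IsIso (affineBlowup.π
        (Ideal.span (Set.range (MvPolynomial.X : Fin 2 → MvPolynomial (Fin 2) k)))) := by
  haveI := isDomain_quot_origin k
  haveI := isRegularRing_quot_origin k
  refine ⟨affineBlowup.isResolution (span_X_plane_ne_bot k) ?_,
    affineBlowup_not_isIso MvPolynomial.X 0 1 (by decide) (isQuasiRegular_X_plane k)⟩
  refine affineBlowup.isRegular_of_isWeaklyRegular (MvPolynomial.X : Fin 2 → MvPolynomial (Fin 2) k) ?_
  rw [List.ofFn_eq_map]
  exact Literature.AlgebraicGeometry.Resolution.MvPolynomial.isWeaklyRegular_map_X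
    (R := k) (List.finRange 2) (List.nodup_finRange 2)

/-- The affine plane over `k` as a `k`-scheme: separated, of finite type, integral, regular. -/
theorem plane_props :
    IsSeparated (Spec.map (CommRingCat.ofHom (algebraMap k (MvPolynomial (Fin 2) k)))) ∧
    LocallyOfFiniteType (Spec.map (CommRingCat.ofHom (algebraMap k (MvPolynomial (Fin 2) k)))) ∧
    QuasiCompact (Spec.map (CommRingCat.ofHom (algebraMap k (MvPolynomial (Fin 2) k)))) ∧
    IsIntegral (Spec (.of (MvPolynomial (Fin 2) k))) ∧
    Scheme.IsRegular (Spec (.of (MvPolynomial (Fin 2) k))) := by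
  refine ⟨inferInstance, ?_, inferInstance, inferInstance, Scheme.isRegular_Spec _⟩
  rw [HasRingHomProperty.Spec_iff (P := @LocallyOfFiniteType)]
  exact RingHom.finiteType_algebraMap.mpr inferInstance

end Plane

/-! ## The refuted strengthenings -/

section Strengthenings

variable (k : Type) [Field k]

/-- **A resolution of a REGULAR integral separated finite-type `k`-scheme need not be an
isomorphism**: the blowing up of the affine plane at the origin. So the weak resolutions handed
out by the crux's antecedent `H_p` are not determined by (and cannot be cut back to the identity
over) the regular locus. [folklore] -/
theorem exists_isResolution_of_isRegular_not_isIso :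
    ∃ (X : Scheme.{0}) (f : X ⟶ Spec (.of k)), IsSeparated f ∧ LocallyOfFiniteType f ∧
      QuasiCompact f ∧ IsIntegral X ∧ Scheme.IsRegular X ∧
      ∃ (X' : Scheme.{0}) (π : X' ⟶ X), IsResolution π ∧ IsIntegral X' ∧ ¬ IsIso π := by
  obtain ⟨hs, hl, hq, hi, hreg⟩ := plane_props k
  obtain ⟨hres, hniso⟩ := blowupPlane_isResolution_not_isIso k
  exact ⟨_, _, hs, hl, hq, hi, hreg, _, _, hres, affineBlowup.isIntegral (span_X_plane_ne_bot k),
    hniso⟩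

/-- **Resolutions are not unique up to isomorphism over the base** (already for the affine
plane: the identity and the blowing up of the origin), so Zariski-local resolutions supplied by
bare existence do not glue for free (Kollár 2007, Rem. 3.28: gluing needs the local
resolutions to AGREE on overlaps). [folklore] -/
theorem resolutions_not_unique :
    ¬ ∀ (X : Scheme.{0}) (f : X ⟶ Spec (.of k)), IsSeparated f → LocallyOfFiniteType f →
        QuasiCompact f → IsIntegral X →
        ∀ (X₁ X₂ : Scheme.{0}) (π₁ : X₁ ⟶ X) (π₂ : X₂ ⟶ X), IsResolution π₁ → IsResolution π₂ →
          ∃ e : X₁ ≅ X₂, e.hom ≫ π₂ = π₁ := by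
  intro h
  obtain ⟨hs, hl, hq, hi, hreg⟩ := plane_props k
  obtain ⟨hres, hniso⟩ := blowupPlane_isResolution_not_isIso k
  have hid : IsResolution (𝟙 (Spec (.of (MvPolynomial (Fin 2) k)))) :=
    ⟨inferInstance, ⟨⊤, by simp, by simp, inferInstance⟩, hreg⟩
  obtain ⟨e, he⟩ := h _ _ hs hl hq hi _ _ (𝟙 _) _ hid hres
  apply hniso
  have : affineBlowup.π (Ideal.span (Set.range (MvPolynomial.X : Fin 2 → MvPolynomial (Fin 2) k))) =
      e.inv := by
    rw [← Category.id_comp (affineBlowup.π _), ← e.inv_hom_id, Category.assoc, he, Category.comp_id]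
  rw [this]
  infer_instance

/-- **Weak is not strong**: a resolution (weak form, as in the summit and in `H_p`) need not be
an isomorphism over the regular locus of the base — the blowing up of the (regular) affine plane
at the origin is not an isomorphism over `U = ⊤ ⊆ Reg`. [folklore] -/
theorem resolution_not_isIso_over_regularLocus :
    ¬ ∀ (X : Scheme.{0}) (f : X ⟶ Spec (.of k)), IsSeparated f → LocallyOfFiniteType f →
        QuasiCompact f → IsIntegral X →
        ∀ (X' : Scheme.{0}) (π : X' ⟶ X), IsResolution π →
          ∀ U : X.Opens, (∀ x : X, x ∈ U → IsRegularLocalRing (X.presheaf.stalk x)) →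
            IsIso (π ∣_ U) := by
  intro h
  obtain ⟨hs, hl, hq, hi, hreg⟩ := plane_props k
  obtain ⟨hres, hniso⟩ := blowupPlane_isResolution_not_isIso k
  have htop := h _ _ hs hl hq hi _ _ hres ⊤ (fun x _ => hreg x)
  apply hniso
  set π := affineBlowup.π (Ideal.span (Set.range (MvPolynomial.X : Fin 2 → MvPolynomial (Fin 2) k)))
  have hc : (π ∣_ ⊤) ≫ (⊤ : (Spec (.of (MvPolynomial (Fin 2) k))).Opens).ι = (π ⁻¹ᵁ ⊤).ι ≫ π :=
    morphismRestrict_ι π ⊤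
  haveI : IsIso ((⊤ : (Spec (.of (MvPolynomial (Fin 2) k))).Opens).ι) := by
    rw [← Scheme.topIso_hom]; infer_instance
  haveI : IsIso ((π ⁻¹ᵁ ⊤).ι) := by
    rw [Scheme.Hom.preimage_top, ← Scheme.topIso_hom]; infer_instance
  haveI : IsIso ((π ⁻¹ᵁ ⊤).ι ≫ π) := by rw [← hc]; infer_instance
  exact IsIso.of_isIso_comp_left ((π ⁻¹ᵁ ⊤).ι) π

/-- At the prime field of every positive characteristic (the setting of the crux): resolutions
of integral separated finite-type `𝔽_p`-schemes are not unique up to isomorphism over the base,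
so the Zariski-local resolutions of the crux's antecedent `H_p` carry no gluing data. [folklore] -/
theorem resolutions_not_unique_primeField (p : ℕ) [Fact p.Prime] :
    ¬ ∀ (X : Scheme.{0}) (f : X ⟶ Spec (.of (ZMod p))), IsSeparated f → LocallyOfFiniteType f →
        QuasiCompact f → IsIntegral X →
        ∀ (X₁ X₂ : Scheme.{0}) (π₁ : X₁ ⟶ X) (π₂ : X₂ ⟶ X), IsResolution π₁ → IsResolution π₂ →
          ∃ e : X₁ ≅ X₂, e.hom ≫ π₂ = π₁ :=
  resolutions_not_unique (ZMod p)

/-- Likewise "weak ⇒ strong for free" fails over every prime field. [folklore] -/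
theorem resolution_not_isIso_over_regularLocus_primeField (p : ℕ) [Fact p.Prime] :
    ¬ ∀ (X : Scheme.{0}) (f : X ⟶ Spec (.of (ZMod p))), IsSeparated f → LocallyOfFiniteType f →
        QuasiCompact f → IsIntegral X →
        ∀ (X' : Scheme.{0}) (π : X' ⟶ X), IsResolution π →
          ∀ U : X.Opens, (∀ x : X, x ∈ U → IsRegularLocalRing (X.presheaf.stalk x)) →
            IsIso (π ∣_ U) :=
  resolution_not_isIso_over_regularLocus (ZMod p)

end Strengthenings

end Summit.ResolutionOfSingularities.ResolutionOfSingularities.Theorems.LocalToGlobal.Negative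

end
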